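import Literature.Geometry.DiscreteGeometry.KissingFacetPenaltyRefined
import Literature.Geometry.DiscreteGeometry.SphericalCodeHullFanSides
import Literature.Geometry.DiscreteGeometry.SphericalCodeHullFanNodeSum
import HarnessLib

/-!
# Deficit and supply of the fan triangles of the Delaunay polyhedron of a kissing configuration
# (Hales 2012, proof of Theorem 2: superadditivity of `d₃` across the long edges)

Topic `Literature/Geometry/DiscreteGeometry`; provefact brick for `Hales2012_contactGraphTame`,
continuing `KissingFanCensus.lean` (contact sides), `KissingFacetPenaltyRefined.lean` (the
refined constants `trianglePenaltyLB₂`), `KissingEdgeDeficit.lean` (the pairing across very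
long hull edges) and `SphericalCodeHullFanSides.lean` / `…FanNodeSum.lean` (the vertex wrapper
lemmas `fVert_mem_tightSet_of_lt`, `fVert_ne_of_ne`).  A fan triangle with two contact sides and a *very long* third side
(`⟪·,·⟫ < 0`; Hales's type `(2,0,1)`) has penalty bound `0` only; Hales recovers the loss from
the triangle across the long side ("the function `d₃` is superadditive … we cannot have
`(r₁,s₁,t₁) = (r₂,s₂,t₂) = (2,0,1)`").  Here this is organised as a DEFICIT/SUPPLY count over
the fan triangles:

* Part A (functions of the three side cosines): `triangleDeficit` (`1` for two contacts and a
  very long side), `triangleSupply` (for at most one contact: the number of very long sides),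
  `triangleUnits = (3 − r) + supply − deficit`, and **`mul_triangleUnits_le_trianglePenaltyLB₂`**:
  `0.103 · units ≤ trianglePenaltyLB₂` in every case (`0.103 ≥ 0.103`, `0.27 ≥ 0.206`,
  `0.36 ≥ 0.309`, `0.49 ≥ 0.412`, `0.5 ≥ 0.309`, `0.63 ≥ 0.618`).
* Part B (the three side cosines `cx`, `cy`, `cz` of the `i`-th fan triangle and the
  indicator form of the counts): `fanContacts_eq`, `eq_half_of_contactCount_eq_two`,
  `eq_half_of_two_le_contactCount`, `fanDeficit_eq_sum` (the deficit is the sum of the three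
  indicators "two contacts and THIS side very long"), `fanSupply_eq_sum`.
* Part C (diagonals, per facet): `diag_lower`, `diag_upper` (a diagonal `{w 0, w k}`, `2 ≤ k ≤ m−2`, that is the very long side of a
  two-contact fan triangle on one of its sides has cosine `0` by the same-facet pairing
  `inner_eq_zero_of_rhombus_tight` — a contradiction — unless the triangle on the other side has
  at most one contact and supplies), and **`sum_diagDeficit_le`**: the deficits whose very long
  side is a diagonal are covered by the supplies on the diagonals.

The polygon sides (deficits there are at most the `edgeDeficit`s of `KissingEdgeDeficit.lean`,
`edgeSupply`s at most the supplies: `sum_polyDeficit_le`, `sum_edgeSupply_le`) and the assembly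
(`Σ deficit ≤ Σ supply`, hence `Σ units ≥ 60 − 2·#contacts`, hence at least `23` contacts) are
in `KissingContactCount.lean`.  Everything here is PROVED; no named facts.

## References
* T. C. Hales, arXiv:1209.6043 (2012), proof of Theorem 2 (superadditivity of `d₃`).
  [`Hales2012`]
-/

noncomputable section

namespace Literature.Geometry.DiscreteGeometry

open Real RealInnerProductSpace Finset

/-! ### Part A. Deficit, supply and units of a triangle from its side cosines -/

/-- The number of very long sides (negative cosine) among three side cosines. [folklore] -/
def veryLongCount (x y z : ℝ) : ℕ :=
  (if x < 0 then 1 else 0) + (if y < 0 then 1 else 0) + (if z < 0 then 1 else 0)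

/-- **Deficit** of a triangle: `1` if it has two contact sides and a very long side (type
`(2,0,1)` with base `> 2√2`: its penalty bound is `0`), else `0`. [cite: Hales2012, proof of
Theorem 2] -/
def triangleDeficit (x y z : ℝ) : ℝ :=
  if contactCount x y z = 2 ∧ (x < 0 ∨ y < 0 ∨ z < 0) then 1 else 0

/-- **Supply** of a triangle: for at most one contact side, the number of its very long sides
(each carries `0.103` more penalty than needed), else `0`. [cite: Hales2012, proof of Theorem 2] -/
def triangleSupply (x y z : ℝ) : ℝ :=
  if contactCount x y z ≤ 1 then (veryLongCount x y z : ℝ) else 0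

/-- **Units** of a triangle: `(3 − r) + supply − deficit`. [folklore] -/
def triangleUnits (x y z : ℝ) : ℝ :=
  (3 - (contactCount x y z : ℝ)) + triangleSupply x y z - triangleDeficit x y z

/-- `contactCount ≤ 3`. [folklore] -/
theorem contactCount_le_three (x y z : ℝ) : contactCount x y z ≤ 3 := by
  unfold contactCount; split_ifs <;> omega

/-- **`0.103 · units ≤ trianglePenaltyLB₂`** casewise (`0 ≤ 0`; `0.103 ≤ 0.103` and `0 ≤ 0` for
two contacts; `0.206 ≤ 0.27`, `0.309 ≤ 0.36` and `0.412 ≤ 0.49` for one contact and `0, 1, 2` very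
long sides; `0.103 (3 + v) ≤ 0.5, 0.63` for none). [cite: Hales2012, Theorem 2 (the constants
d₃)] -/
theorem mul_triangleUnits_le_trianglePenaltyLB₂ (x y z : ℝ) :
    0.103 * triangleUnits x y z ≤ trianglePenaltyLB₂ x y z := by
  unfold triangleUnits triangleSupply triangleDeficit trianglePenaltyLB₂ trianglePenaltyLB
    veryLongCount
  by_cases hx : x = 1 / 2 <;> by_cases hy : y = 1 / 2 <;> by_cases hz : z = 1 / 2
  · have hcc : contactCount x y z = 3 := by rw [contactCount, if_pos hx, if_pos hy, if_pos hz]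
    rw [hcc]; norm_num
  · have hcc : contactCount x y z = 2 := by rw [contactCount, if_pos hx, if_pos hy, if_neg hz]
    rw [hcc]; norm_num; split_ifs <;> norm_num
  · have hcc : contactCount x y z = 2 := by rw [contactCount, if_pos hx, if_neg hy, if_pos hz]
    rw [hcc]; norm_num; split_ifs <;> norm_num
  · have hcc : contactCount x y z = 1 := by rw [contactCount, if_pos hx, if_neg hy, if_neg hz]
    rw [hcc]; norm_num
    have hx0 : ¬x < 0 := by rw [hx]; norm_num
    split_ifs <;> norm_num
    all_goals simp_all
  · have hcc : contactCount x y z = 2 := by rw [contactCount, if_neg hx, if_pos hy, if_pos hz]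
    rw [hcc]; norm_num; split_ifs <;> norm_num
  · have hcc : contactCount x y z = 1 := by rw [contactCount, if_neg hx, if_pos hy, if_neg hz]
    rw [hcc]; norm_num
    have hy0 : ¬y < 0 := by rw [hy]; norm_num
    split_ifs <;> norm_num
    all_goals simp_all
  · have hcc : contactCount x y z = 1 := by rw [contactCount, if_neg hx, if_neg hy, if_pos hz]
    rw [hcc]; norm_num
    have hz0 : ¬z < 0 := by rw [hz]; norm_num
    split_ifs <;> norm_num
    all_goals simp_all
  · have hcc : contactCount x y z = 0 := by rw [contactCount, if_neg hx, if_neg hy, if_neg hz]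
    rw [hcc]; norm_num; split_ifs <;> norm_num
    all_goals simp_all

section PerFacet

local notation "E3" => EuclideanSpace ℝ (Fin 3)

variable {X : Finset E3}

/-- The deficit of the `i`-th fan triangle of the facet of `c`. [folklore] -/
def fanDeficit (X : Finset E3) (c : E3) (i : ℕ) : ℝ :=
  triangleDeficit ⟪fVert X c (i + 1), fVert X c (i + 2)⟫ ⟪fVert X c 0, fVert X c (i + 2)⟫
    ⟪fVert X c 0, fVert X c (i + 1)⟫

/-- The supply of the `i`-th fan triangle of the facet of `c`. [folklore] -/
def fanSupply (X : Finset E3) (c : E3) (i : ℕ) : ℝ :=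
  triangleSupply ⟪fVert X c (i + 1), fVert X c (i + 2)⟫ ⟪fVert X c 0, fVert X c (i + 2)⟫
    ⟪fVert X c 0, fVert X c (i + 1)⟫

/-- The units of the `i`-th fan triangle of the facet of `c`. [folklore] -/
def fanUnits (X : Finset E3) (c : E3) (i : ℕ) : ℝ :=
  triangleUnits ⟪fVert X c (i + 1), fVert X c (i + 2)⟫ ⟪fVert X c 0, fVert X c (i + 2)⟫
    ⟪fVert X c 0, fVert X c (i + 1)⟫

/-- `fanUnits = (3 − fanContacts) + fanSupply − fanDeficit`. [folklore] -/
theorem fanUnits_eq (X : Finset E3) (c : E3) (i : ℕ) :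
    fanUnits X c i = (3 - (fanContacts X c i : ℝ)) + fanSupply X c i - fanDeficit X c i := rfl

/-- `0.103 · fanUnits ≤ fanPenaltyLB₂`. [cite: Hales2012, Theorem 2] -/
theorem mul_fanUnits_le_fanPenaltyLB₂ (X : Finset E3) (c : E3) (i : ℕ) :
    0.103 * fanUnits X c i ≤ fanPenaltyLB₂ X c i :=
  mul_triangleUnits_le_trianglePenaltyLB₂ _ _ _


/-! ### Part B. The three side cosines; deficit and supply as sums of indicators -/

/-- The cosine of the polygon-side `{w (i+1), w (i+2)}` of the `i`-th fan triangle. [folklore] -/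
def cx (X : Finset E3) (c : E3) (i : ℕ) : ℝ := ⟪fVert X c (i + 1), fVert X c (i + 2)⟫
/-- The cosine of the side `{w 0, w (i+2)}` of the `i`-th fan triangle. [folklore] -/
def cy (X : Finset E3) (c : E3) (i : ℕ) : ℝ := ⟪fVert X c 0, fVert X c (i + 2)⟫
/-- The cosine of the side `{w 0, w (i+1)}` of the `i`-th fan triangle. [folklore] -/
def cz (X : Finset E3) (c : E3) (i : ℕ) : ℝ := ⟪fVert X c 0, fVert X c (i + 1)⟫

/-- `fanContacts` through the three cosines. [folklore] -/
theorem fanContacts_eq (X : Finset E3) (c : E3) (i : ℕ) :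
    fanContacts X c i = contactCount (cx X c i) (cy X c i) (cz X c i) := rfl

/-- With two contacts, a very long side forces the other two sides to be the contacts.
[folklore] -/
theorem eq_half_of_contactCount_eq_two {x y z : ℝ} (h : contactCount x y z = 2) :
    (x < 0 → y = 1 / 2 ∧ z = 1 / 2) ∧ (y < 0 → x = 1 / 2 ∧ z = 1 / 2) ∧
      (z < 0 → x = 1 / 2 ∧ y = 1 / 2) := by
  unfold contactCount at h
  refine ⟨fun hx => ?_, fun hy => ?_, fun hz => ?_⟩
  · have hx' : ¬x = 1 / 2 := fun e => by rw [e] at hx; norm_num at hx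
    rw [if_neg hx'] at h
    by_cases hy : y = 1 / 2 <;> by_cases hz : z = 1 / 2 <;> simp only [hy, hz, if_true, if_false] at h
      <;> first | exact ⟨hy, hz⟩ | (norm_num at h)
  · have hy' : ¬y = 1 / 2 := fun e => by rw [e] at hy; norm_num at hy
    rw [if_neg hy'] at h
    by_cases hx : x = 1 / 2 <;> by_cases hz : z = 1 / 2 <;> simp only [hx, hz, if_true, if_false] at h
      <;> first | exact ⟨hx, hz⟩ | (norm_num at h)
  · have hz' : ¬z = 1 / 2 := fun e => by rw [e] at hz; norm_num at hz
    rw [if_neg hz'] at h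
    by_cases hx : x = 1 / 2 <;> by_cases hy : y = 1 / 2 <;> simp only [hx, hy, if_true, if_false] at h
      <;> first | exact ⟨hx, hy⟩ | (norm_num at h)

/-- With at least two contacts and a non-contact side, the other two sides are the contacts.
[folklore] -/
theorem eq_half_of_two_le_contactCount {x y z : ℝ} (h : 2 ≤ contactCount x y z) (hx : x ≠ 1 / 2) :
    y = 1 / 2 ∧ z = 1 / 2 := by
  unfold contactCount at h
  rw [if_neg hx] at h
  by_cases hy : y = 1 / 2 <;> by_cases hz : z = 1 / 2 <;> simp only [hy, hz, if_true, if_false] at h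
    <;> first | exact ⟨hy, hz⟩ | (norm_num at h)

/-- **The deficit of a fan triangle is the sum of the three "two contacts and THIS side very
long" indicators** (with two contacts at most one side is very long). [folklore] -/
theorem fanDeficit_eq_sum (X : Finset E3) (c : E3) (i : ℕ) :
    fanDeficit X c i = (if fanContacts X c i = 2 ∧ cx X c i < 0 then 1 else 0) +
      (if fanContacts X c i = 2 ∧ cy X c i < 0 then 1 else 0) +
      (if fanContacts X c i = 2 ∧ cz X c i < 0 then 1 else 0) := by
  rw [fanDeficit, fanContacts_eq]
  unfold triangleDeficit
  change (if contactCount (cx X c i) (cy X c i) (cz X c i) = 2 ∧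
      (cx X c i < 0 ∨ cy X c i < 0 ∨ cz X c i < 0) then (1 : ℝ) else 0) = _
  by_cases h2 : contactCount (cx X c i) (cy X c i) (cz X c i) = 2
  · obtain ⟨hxz, hyz, hzz⟩ := eq_half_of_contactCount_eq_two h2
    by_cases hx : cx X c i < 0
    · have hy : ¬cy X c i < 0 := by rw [(hxz hx).1]; norm_num
      have hz : ¬cz X c i < 0 := by rw [(hxz hx).2]; norm_num
      simp [h2, hx, hy, hz]
    by_cases hy : cy X c i < 0
    · have hz : ¬cz X c i < 0 := by rw [(hyz hy).2]; norm_num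
      simp [h2, hx, hy, hz]
    by_cases hz : cz X c i < 0
    · simp [h2, hx, hy, hz]
    · simp [h2, hx, hy, hz]
  · simp [h2]

/-- **The supply of a fan triangle is the sum of the three "at most one contact and THIS side
very long" indicators.** [folklore] -/
theorem fanSupply_eq_sum (X : Finset E3) (c : E3) (i : ℕ) :
    fanSupply X c i = (if fanContacts X c i ≤ 1 ∧ cx X c i < 0 then 1 else 0) +
      (if fanContacts X c i ≤ 1 ∧ cy X c i < 0 then 1 else 0) +
      (if fanContacts X c i ≤ 1 ∧ cz X c i < 0 then 1 else 0) := by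
  rw [fanSupply, fanContacts_eq]
  unfold triangleSupply veryLongCount
  change (if contactCount (cx X c i) (cy X c i) (cz X c i) ≤ 1 then
      (((if cx X c i < 0 then 1 else 0) + (if cy X c i < 0 then 1 else 0) +
        (if cz X c i < 0 then 1 else 0) : ℕ) : ℝ) else 0) = _
  by_cases h1 : contactCount (cx X c i) (cy X c i) (cz X c i) ≤ 1
  · rw [if_pos h1]
    by_cases hx : cx X c i < 0 <;> by_cases hy : cy X c i < 0 <;> by_cases hz : cz X c i < 0 <;>
      simp [h1, hx, hy, hz] <;> norm_num
  · simp [h1]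

/-! ### Part C. Diagonals: the deficit on a diagonal is covered by the supply of the adjacent
fan triangle on that diagonal -/

section Diagonals

variable (hX1 : ∀ y ∈ X, ‖y‖ = 1) {c : E3} (hc : c ∈ facetNormals X)
include hX1 hc

/-- **Lower triangle on a diagonal**: if the fan triangle `i` (`i + 3 < m`) has two contacts and
its side `{w 0, w (i+2)}` very long, then the fan triangle `i + 1` (on the same diagonal) has at
most one contact (same-facet pairing) and that very long side. [cite: Hales2012, proof of
Theorem 2 (superadditivity of d₃)] -/
theorem diag_lower {i : ℕ} (hi : i + 3 < (tightSet X c).card) (h2 : fanContacts X c i = 2)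
    (hy : cy X c i < 0) : fanContacts X c (i + 1) ≤ 1 ∧ cz X c (i + 1) < 0 := by
  have hzlt : cz X c (i + 1) < 0 := by
    unfold cz; rw [show i + 1 + 1 = i + 2 by ring]; exact hy
  refine ⟨?_, hzlt⟩
  by_contra hgt
  have hge : 2 ≤ fanContacts X c (i + 1) := by omega
  rw [fanContacts_eq] at h2 hge
  obtain ⟨hx, hz⟩ := (eq_half_of_contactCount_eq_two h2).2.1 hy
  have hz1 : cz X c (i + 1) ≠ 1 / 2 := fun e => by rw [e] at hzlt; norm_num at hzlt
  -- in `contactCount (cx (i+1)) (cy (i+1)) (cz (i+1))` the third argument is not a contact: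
  -- permute to use `eq_half_of_two_le_contactCount`
  have hperm : contactCount (cx X c (i + 1)) (cy X c (i + 1)) (cz X c (i + 1)) =
      contactCount (cz X c (i + 1)) (cx X c (i + 1)) (cy X c (i + 1)) := by
    unfold contactCount; ring
  rw [hperm] at hge
  obtain ⟨hx', hy'⟩ := eq_half_of_two_le_contactCount hge hz1
  -- the rhombus `w(i+1), w 0, w(i+3), w(i+2)`
  unfold cx at hx hx'
  unfold cy at hy hy'
  unfold cz at hz
  rw [show i + 1 + 1 = i + 2 by ring] at hx'
  rw [show i + 1 + 2 = i + 3 by ring] at hx' hy'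
  have hm := hi
  have hv := hX1 _ (mem_tightSet.1 (fVert_mem_tightSet_of_lt hX1 hc (j := i + 1) (by omega))).1
  have hw := hX1 _ (mem_tightSet.1 (fVert_mem_tightSet_of_lt hX1 hc (j := i + 3) (by omega))).1
  have hb := hX1 _ (mem_tightSet.1 (fVert_mem_tightSet_of_lt hX1 hc (j := 0) (by omega))).1
  have hxv := hX1 _ (mem_tightSet.1 (fVert_mem_tightSet_of_lt hX1 hc (j := i + 2) (by omega))).1
  have h0 := inner_eq_zero_of_rhombus_tight (v := fVert X c (i + 1)) (w := fVert X c (i + 3))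
    (b := fVert X c 0) (x := fVert X c (i + 2)) hv hw hb hxv
    (by rw [real_inner_comm]; exact hz) hx (by rw [real_inner_comm]; exact hy')
    (by rw [real_inner_comm]; exact hx')
    (fVert_ne_of_ne hX1 hc (by omega) (by omega) (by omega))
    (fVert_ne_of_ne hX1 hc (by omega) (by omega) (by omega))
    (mem_tightSet.1 (fVert_mem_tightSet_of_lt hX1 hc (by omega))).2
    (mem_tightSet.1 (fVert_mem_tightSet_of_lt hX1 hc (by omega))).2
    (mem_tightSet.1 (fVert_mem_tightSet_of_lt hX1 hc (by omega))).2
    (mem_tightSet.1 (fVert_mem_tightSet_of_lt hX1 hc (by omega))).2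
  rw [h0] at hy
  exact lt_irrefl 0 hy

/-- **Upper triangle on a diagonal**: if the fan triangle `i` (`1 ≤ i`, `i + 2 < m`) has two
contacts and its side `{w 0, w (i+1)}` very long, then the fan triangle `i − 1` has at most one
contact and that very long side. [cite: Hales2012, proof of Theorem 2 (superadditivity of d₃)] -/
theorem diag_upper {i : ℕ} (hi1 : 1 ≤ i) (hi : i + 2 < (tightSet X c).card)
    (h2 : fanContacts X c i = 2) (hz : cz X c i < 0) :
    fanContacts X c (i - 1) ≤ 1 ∧ cy X c (i - 1) < 0 := by
  obtain ⟨k, rfl⟩ : ∃ k, i = k + 1 := ⟨i - 1, by omega⟩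
  rw [show k + 1 - 1 = k by omega]
  have hylt : cy X c k < 0 := by
    unfold cy; unfold cz at hz; rw [show k + 2 = k + 1 + 1 by ring]; exact hz
  refine ⟨?_, hylt⟩
  by_contra hgt
  have hge : 2 ≤ fanContacts X c k := by omega
  rw [fanContacts_eq] at h2 hge
  obtain ⟨hx, hy⟩ := (eq_half_of_contactCount_eq_two h2).2.2 hz
  have hy1 : cy X c k ≠ 1 / 2 := fun e => by rw [e] at hylt; norm_num at hylt
  have hperm : contactCount (cx X c k) (cy X c k) (cz X c k) =
      contactCount (cy X c k) (cx X c k) (cz X c k) := by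
    unfold contactCount; ring
  rw [hperm] at hge
  obtain ⟨hx', hz'⟩ := eq_half_of_two_le_contactCount hge hy1
  -- the rhombus `w(k+1), w 0, w(k+3), w(k+2)`: contacts `w(k+1)–w0` (hz'), `w(k+1)–w(k+2)` (hx'),
  -- `w(k+3)–w(k+2)` (hx), `w(k+3)–w0` (hy); diagonal `w 0, w (k+2)` with cosine `cz (k+1) < 0`
  unfold cx at hx hx'
  unfold cy at hy
  unfold cz at hz hz'
  rw [show k + 1 + 1 = k + 2 by ring] at hx hz
  rw [show k + 1 + 2 = k + 3 by ring] at hx hy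
  have hv := hX1 _ (mem_tightSet.1 (fVert_mem_tightSet_of_lt hX1 hc (j := k + 1) (by omega))).1
  have hw := hX1 _ (mem_tightSet.1 (fVert_mem_tightSet_of_lt hX1 hc (j := k + 3) (by omega))).1
  have hb := hX1 _ (mem_tightSet.1 (fVert_mem_tightSet_of_lt hX1 hc (j := 0) (by omega))).1
  have hxv := hX1 _ (mem_tightSet.1 (fVert_mem_tightSet_of_lt hX1 hc (j := k + 2) (by omega))).1
  have h0 := inner_eq_zero_of_rhombus_tight (v := fVert X c (k + 1)) (w := fVert X c (k + 3))
    (b := fVert X c 0) (x := fVert X c (k + 2)) hv hw hb hxv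
    (by rw [real_inner_comm]; exact hz') hx' (by rw [real_inner_comm]; exact hy)
    (by rw [real_inner_comm]; exact hx)
    (fVert_ne_of_ne hX1 hc (by omega) (by omega) (by omega))
    (fVert_ne_of_ne hX1 hc (by omega) (by omega) (by omega))
    (mem_tightSet.1 (fVert_mem_tightSet_of_lt hX1 hc (by omega))).2
    (mem_tightSet.1 (fVert_mem_tightSet_of_lt hX1 hc (by omega))).2
    (mem_tightSet.1 (fVert_mem_tightSet_of_lt hX1 hc (by omega))).2
    (mem_tightSet.1 (fVert_mem_tightSet_of_lt hX1 hc (by omega))).2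
  rw [h0] at hz
  exact lt_irrefl 0 hz

/-- **The diagonal deficits of a facet are covered by its diagonal supplies**:
`Σ_{i<m−3} [r(i)=2 ∧ cy i<0] + Σ_{1≤i<m−2} [r(i)=2 ∧ cz i<0]
  ≤ Σ_{1≤i<m−2} [r(i)≤1 ∧ cz i<0] + Σ_{i<m−3} [r(i)≤1 ∧ cy i<0]`.
[cite: Hales2012, proof of Theorem 2 (superadditivity of d₃)] -/
theorem sum_diagDeficit_le :
    (∑ i ∈ range ((tightSet X c).card - 3),
        (if fanContacts X c i = 2 ∧ cy X c i < 0 then (1 : ℝ) else 0)) +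
      (∑ i ∈ Ico 1 ((tightSet X c).card - 2),
        (if fanContacts X c i = 2 ∧ cz X c i < 0 then (1 : ℝ) else 0)) ≤
    (∑ i ∈ Ico 1 ((tightSet X c).card - 2),
        (if fanContacts X c i ≤ 1 ∧ cz X c i < 0 then (1 : ℝ) else 0)) +
      (∑ i ∈ range ((tightSet X c).card - 3),
        (if fanContacts X c i ≤ 1 ∧ cy X c i < 0 then (1 : ℝ) else 0)) := by
  set m := (tightSet X c).card with hm
  have hm3 : 3 ≤ m := three_le_card_tightSet hc
  -- lower triangles: shift by one into `Ico 1 (m-2)`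
  have hB : ∑ i ∈ range (m - 3), (if fanContacts X c i = 2 ∧ cy X c i < 0 then (1 : ℝ) else 0) ≤
      ∑ i ∈ Ico 1 (m - 2), (if fanContacts X c i ≤ 1 ∧ cz X c i < 0 then (1 : ℝ) else 0) := by
    rw [Finset.sum_Ico_eq_sum_range, show m - 2 - 1 = m - 3 by omega]
    refine Finset.sum_le_sum fun i hi => ?_
    have him := mem_range.1 hi
    split_ifs with h h'
    · exact le_rfl
    · exact absurd (by rw [add_comm]; exact diag_lower hX1 hc (by omega) h.1 h.2) h'
    · exact zero_le_one
    · exact le_rfl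
  -- upper triangles: shift by one into `range (m-3)`
  have hC : ∑ i ∈ Ico 1 (m - 2), (if fanContacts X c i = 2 ∧ cz X c i < 0 then (1 : ℝ) else 0) ≤
      ∑ i ∈ range (m - 3), (if fanContacts X c i ≤ 1 ∧ cy X c i < 0 then (1 : ℝ) else 0) := by
    rw [Finset.sum_Ico_eq_sum_range, show m - 2 - 1 = m - 3 by omega]
    refine Finset.sum_le_sum fun i hi => ?_
    have him := mem_range.1 hi
    split_ifs with h h'
    · exact le_rfl
    · have := diag_upper hX1 hc (i := 1 + i) (by omega) (by omega) h.1 h.2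
      rw [show 1 + i - 1 = i by omega] at this
      exact absurd this h'
    · exact zero_le_one
    · exact le_rfl
  linarith

end Diagonals

end PerFacet

end Literature.Geometry.DiscreteGeometry

end
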